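import Summits.Ventures.Crystal3D.Theorems.StickyWulffConstantCoaxialWallLawInPlaneRunEnds
import HarnessLib

/-!
# In-plane run ends of the TOP grain in the two-slab cell: located counts (all fillings), mirror of `…InPlaneRunEnds`

HONEST FRAMING. Part of the venture `Summits/Ventures/Crystal3D` (cell `crystal3d-full`), helper
`--supports` the crux `CoaxialWallLaw` (stmt-Ventures-19481, `route-Ventures-StickyWulffConstant`),
REGISTERED line `WallLedgerF` (planner cf-p1 gen 16), open stub `stub_coaxialTwoSlabAdhesion`.
RUNG CREDIT ONLY; F-C1 not moved.  The mirror image (`z ↦ h − z`, grains swapped) of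
`…CoaxialWallLawInPlaneRunEnds`: runs of the TOP grain `Λ₂ = A₂·Λ₀ + t₂` rooted in the inner top sample and
followed DOWNWARDS along a non-ascending slot `d = A₂ u` that is a period of `Λ₁`; their ends `e ∈ X ∩ Λ₂ ∖ Λ₁`,
`e + d ∉ X`, located in the same payer window `−R₀ − 2 ≤ e₂ ≤ h + R₀ + 2`.  Used by the two-sided layered /
off-site laws (both grains' rows end at the risers: the charge doubles).

* `card_inPlane_runEnds_top_ge_tops` — located ends `≥ #{tops of the inner top sample off Λ₁} − 72 R₀ ρ`
  (`card_runTops_le`; an end above the payer window would have its successor in `P₂`; an end off `Λ₁` below it is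
  sealed out of the bottom clamp, `sealing_below`; two rim shells).
* `card_inPlane_runEnds_top_ge_of_disjoint` — `Λ₁ ∩ Λ₂ = ∅`: `≥ √2 |⟪d, e₃⟫| π (ρ − 1)² − 10 √2 π (ρ − 1) − 72 R₀ ρ`.
* `card_inPlane_runEnds_top_ge_of_shift` — a unit `g` with `Λ₂ ± g = Λ₂`, `x + g, x + 2g ∉ Λ₁` for `x ∈ Λ₁`
  (twins): `≥ (2/3)(√2 |⟪d, e₃⟫| π (ρ − 2)² − 10 √2 π (ρ − 2)) − 72 R₀ ρ` (`…TwoThirds`).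

WHAT THIS IS NOT: no deficiency is claimed here; F-C1 not moved.
-/

noncomputable section

namespace Summit.Ventures.Crystal3D.Theorems

open Summit.Ventures.Crystal3D Finset
open Literature.MathematicalPhysics.StatisticalMechanics (fccStacking)
open scoped InnerProductSpace

open scoped Classical in
/-- **Located in-plane run ends OF THE TOP GRAIN are at least the off-`Λ₁` tops of the inner top sample.**  See the
module docstring.  `P'` is the inner top sample `Λ₂ ∩ {h + R₀ + 1 ≤ p₂ ≤ h + 2R₀ − 1, lateral ≤ (ρ − 1)²}`. -/
theorem card_inPlane_runEnds_top_ge_tops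
    (A₁ : EuclideanSpace ℝ (Fin 3) ≃ₗᵢ[ℝ] EuclideanSpace ℝ (Fin 3)) (t₁ : EuclideanSpace ℝ (Fin 3))
    (A₂ : EuclideanSpace ℝ (Fin 3) ≃ₗᵢ[ℝ] EuclideanSpace ℝ (Fin 3)) (t₂ : EuclideanSpace ℝ (Fin 3))
    (X P₁ P₂ P' : Finset (EuclideanSpace ℝ (Fin 3))) (R₀ h ρ : ℝ) (hR₀ : 3 ≤ R₀) (hρ : R₀ ≤ ρ)
    (hX : ∀ p ∈ X, ∀ q ∈ X, p ≠ q → 1 ≤ dist p q)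
    (hcell : ∀ p ∈ X, -(2 * R₀) ≤ p 2 ∧ p 2 ≤ h + 2 * R₀ ∧ p 0 ^ 2 + p 1 ^ 2 ≤ ρ ^ 2)
    (hP₁X : P₁ ⊆ X) (hP₂X : P₂ ⊆ X)
    (hP₁ : ∀ p, p ∈ P₁ ↔ (p ∈ (fun q => A₁ q + t₁) '' fccStacking 1 (Real.sqrt (2 / 3)) ∧
      -(2 * R₀) ≤ p 2 ∧ p 2 ≤ -R₀ ∧ p 0 ^ 2 + p 1 ^ 2 ≤ ρ ^ 2))
    (hP₂ : ∀ p, p ∈ P₂ ↔ (p ∈ (fun q => A₂ q + t₂) '' fccStacking 1 (Real.sqrt (2 / 3)) ∧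
      h + R₀ ≤ p 2 ∧ p 2 ≤ h + 2 * R₀ ∧ p 0 ^ 2 + p 1 ^ 2 ≤ ρ ^ 2))
    (hP' : ∀ p, p ∈ P' ↔ (p ∈ (fun q => A₂ q + t₂) '' fccStacking 1 (Real.sqrt (2 / 3)) ∧
      h + R₀ + 1 ≤ p 2 ∧ p 2 ≤ h + 2 * R₀ - 1 ∧ p 0 ^ 2 + p 1 ^ 2 ≤ (ρ - 1) ^ 2))
    {u : EuclideanSpace ℝ (Fin 3)} (hu : u ∈ fccSlots)
    (hdown : ⟪A₂ u, EuclideanSpace.single (2 : Fin 3) (1 : ℝ)⟫_ℝ ≤ 0)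
    (hinv₁ : ∀ x, x ∈ (fun q => A₁ q + t₁) '' fccStacking 1 (Real.sqrt (2 / 3)) →
      x + A₂ u ∈ (fun q => A₁ q + t₁) '' fccStacking 1 (Real.sqrt (2 / 3)) ∧
      x - A₂ u ∈ (fun q => A₁ q + t₁) '' fccStacking 1 (Real.sqrt (2 / 3))) :
    ((((P'.filter fun p => p + A₂ u ∉ P').filter fun p =>
        p ∉ (fun q => A₁ q + t₁) '' fccStacking 1 (Real.sqrt (2 / 3))).card : ℕ) : ℝ) - 72 * R₀ * ρ ≤
      ((X.filter fun e => e ∈ (fun q => A₂ q + t₂) '' fccStacking 1 (Real.sqrt (2 / 3)) ∧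
        e ∉ (fun q => A₁ q + t₁) '' fccStacking 1 (Real.sqrt (2 / 3)) ∧
        e + A₂ u ∉ X ∧ -R₀ - 2 ≤ e 2 ∧ e 2 ≤ h + R₀ + 2).card : ℝ) := by
  set e₃ : EuclideanSpace ℝ (Fin 3) := EuclideanSpace.single (2 : Fin 3) (1 : ℝ) with he₃
  set Λ₁ := (fun q => A₁ q + t₁) '' fccStacking 1 (Real.sqrt (2 / 3)) with hΛ₁
  set Λ₂ := (fun q => A₂ q + t₂) '' fccStacking 1 (Real.sqrt (2 / 3)) with hΛ₂
  set d : EuclideanSpace ℝ (Fin 3) := A₂ u with hd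
  have hρ1 : (1 : ℝ) ≤ ρ := by linarith
  have hρ2 : (2 : ℝ) ≤ ρ := by linarith
  have huΛ : u ∈ fccStacking 1 (Real.sqrt (2 / 3)) := mem_fcc_of_mem_fccSlots hu
  have hd1 : ‖d‖ = 1 := by rw [hd, LinearIsometryEquiv.norm_map, norm_eq_one_of_mem_fccSlots hu]
  have hd0 : d ≠ 0 := by
    intro h0; rw [h0, norm_zero] at hd1; norm_num at hd1
  have hd2 : d 2 = ⟪A₂ u, e₃⟫_ℝ := apply_two_eq_inner_e₃ _
  have hd2le : -1 ≤ d 2 := by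
    have := abs_inner_slot_le_one A₂ hu
    rw [hd2]; exact (neg_le_neg this).trans (neg_abs_le _)
  have hd2np : d 2 ≤ 0 := by rw [hd2]; exact hdown
  -- off `Λ₁` is constant along `d`
  have hN : ∀ q, q ∉ Λ₁ ↔ q + d ∉ Λ₁ := by
    intro q
    constructor
    · intro hq hq'
      have := (hinv₁ (q + d) hq').2
      rw [add_sub_cancel_right] at this
      exact hq this
    · intro hq hq'
      exact hq (hinv₁ q hq').1
  -- the off-`Λ₁` part of the inner sample
  set P'N := P'.filter fun p => p ∉ Λ₁ with hP'N
  have hP'P₂ : P' ⊆ P₂ := by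
    intro p hp
    obtain ⟨hΛ, h1, h2, h3⟩ := (hP' p).1 hp
    have hρ0 : (0 : ℝ) ≤ ρ - 1 := by linarith
    exact (hP₂ p).2 ⟨hΛ, by linarith, by linarith, by nlinarith⟩
  have hP'NX : P'N ⊆ X := (filter_subset _ _).trans (hP'P₂.trans hP₂X)
  have hconvP' := runConvex_clampedSample A₂ t₂ (h + R₀ + 1) (h + 2 * R₀ - 1) (ρ - 1) (by linarith) P' hP' huΛ
  have hconvN : ∀ p ∈ P'N, ∀ D : ℕ, p + ((D : ℕ) : ℝ) • d ∈ P'N → ∀ k : ℕ, k ≤ D →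
      p + ((k : ℕ) : ℝ) • d ∈ P'N := by
    intro p hp D hD k hk
    rw [hP'N, mem_filter] at hp hD ⊢
    exact ⟨hconvP' p hp.1 D hD.1 k hk, (pred_add_nsmul_iff (N := fun q => q ∉ Λ₁) hN p k).2 hp.2⟩
  -- run tops of `P'N` inject into run ends of `X` on forward rays
  have h1 := card_runTops_le X P'N d hd0 hP'NX hconvN
  -- the `N`-tops of `P'` are tops of `P'N`
  have h0 : ((P'.filter fun p => p + d ∉ P').filter fun p => p ∉ Λ₁) ⊆ P'N.filter fun p => p + d ∉ P'N := by
    intro p hp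
    rw [mem_filter, mem_filter] at hp
    rw [mem_filter, hP'N, mem_filter, mem_filter]
    exact ⟨⟨hp.1.1, hp.2⟩, fun h' => hp.1.2 h'.1⟩
  -- locate the run ends
  set ENDS := X.filter fun e => e ∈ Λ₂ ∧ e ∉ Λ₁ ∧ e + d ∉ X ∧ -R₀ - 2 ≤ e 2 ∧ e 2 ≤ h + R₀ + 2
    with hENDS
  set RIMlo := X.filter fun x => -(2 * R₀) ≤ x 2 ∧ x 2 ≤ -R₀ - 2 ∧ (ρ - 1) ^ 2 < x 0 ^ 2 + x 1 ^ 2 ∧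
    x 0 ^ 2 + x 1 ^ 2 ≤ ρ ^ 2 with hRIMlo
  set RIMhi := X.filter fun x => h + R₀ + 2 ≤ x 2 ∧ x 2 ≤ h + 2 * R₀ ∧ (ρ - 1) ^ 2 < x 0 ^ 2 + x 1 ^ 2 ∧
    x 0 ^ 2 + x 1 ^ 2 ≤ ρ ^ 2 with hRIMhi
  have hsplit : (X.filter fun q => q + d ∉ X ∧ ∃ p ∈ P'N, ∃ m : ℕ, q = p + ((m : ℕ) : ℝ) • d) ⊆
      ENDS ∪ RIMlo ∪ RIMhi := by
    intro q hq
    rw [mem_filter] at hq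
    obtain ⟨hqX, hqd, p, hp, m, hqpm⟩ := hq
    rw [hP'N, mem_filter] at hp
    obtain ⟨hpP', hpN⟩ := hp
    have hpΛ₂ : p ∈ Λ₂ := ((hP' p).1 hpP').1
    have hqΛ₂ : q ∈ Λ₂ := by rw [hqpm]; exact movedFcc_add_nsmul_site_mem A₂ t₂ hpΛ₂ huΛ m
    have hqN : q ∉ Λ₁ := by rw [hqpm]; exact (pred_add_nsmul_iff (N := fun q => q ∉ Λ₁) hN p m).2 hpN
    have hqP₁ : q ∉ P₁ := fun h' => hqN ((hP₁ q).1 h').1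
    obtain ⟨hqz1, hqz2, hqlat⟩ := hcell q hqX
    by_cases hhi : h + R₀ + 2 < q 2
    · -- the successor would be a ball of `P₂` unless `q` is on the rim
      refine mem_union_right _ ?_
      rw [hRIMhi, mem_filter]
      refine ⟨hqX, hhi.le, hqz2, ?_, hqlat⟩
      by_contra hr
      push Not at hr
      have hlat' : (q + d) 0 ^ 2 + (q + d) 1 ^ 2 ≤ ρ ^ 2 := by
        have := lateral_sq_le_of_dist_le_one (y := q + d) (q := q) (r := ρ - 1) (by linarith) hr
          (by rw [dist_eq_norm, add_sub_cancel_left, hd1])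
        rwa [sub_add_cancel] at this
      have hqdΛ₂ : q + d ∈ Λ₂ := movedFcc_add_site_mem A₂ t₂ hqΛ₂ huΛ
      have h2' : (q + d) 2 = q 2 + d 2 := by simp
      have hqdP₂ : q + d ∈ P₂ := (hP₂ _).2 ⟨hqdΛ₂, by rw [h2']; linarith, by rw [h2']; linarith, hlat'⟩
      exact hqd (hP₂X hqdP₂)
    by_cases hlo : q 2 < -R₀ - 2
    · refine mem_union_left _ (mem_union_right _ ?_)
      rw [hRIMlo, mem_filter]
      refine ⟨hqX, hqz1, hlo.le, ?_, hqlat⟩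
      by_contra hr
      push Not at hr
      exact sealing_below A₁ t₁ (-(2 * R₀)) (-R₀) ρ hρ1 X P₁ hX hP₁X hP₁ q hqX hqP₁ hqz1 (by linarith) hr
    · push Not at hlo hhi
      refine mem_union_left _ (mem_union_left _ ?_)
      rw [hENDS, mem_filter]
      exact ⟨hqX, hqΛ₂, hqN, hqd, hlo, hhi⟩
  have hRIMlo_le : (RIMlo.card : ℝ) ≤ 36 * R₀ * ρ := by
    have h1 := card_rim_window_le X (-(2 * R₀)) (-R₀ - 2) ρ (by linarith) hρ2 hX RIMlo
      (filter_subset _ _) (fun p hp => (mem_filter.1 hp).2)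
    have e : 6 * (-R₀ - 2 - -(2 * R₀) + 2) * (6 * ρ - 3) = 36 * R₀ * ρ - 18 * R₀ := by ring
    rw [e] at h1
    have : (0 : ℝ) ≤ 18 * R₀ := by linarith
    linarith
  have hRIMhi_le : (RIMhi.card : ℝ) ≤ 36 * R₀ * ρ := by
    have h1 := card_rim_window_le X (h + R₀ + 2) (h + 2 * R₀) ρ (by linarith) hρ2 hX RIMhi
      (filter_subset _ _) (fun p hp => (mem_filter.1 hp).2)
    have e : 6 * (h + 2 * R₀ - (h + R₀ + 2) + 2) * (6 * ρ - 3) = 36 * R₀ * ρ - 18 * R₀ := by ring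
    rw [e] at h1
    have : (0 : ℝ) ≤ 18 * R₀ := by linarith
    linarith
  have hcard : ((P'.filter fun p => p + d ∉ P').filter fun p => p ∉ Λ₁).card ≤
      ENDS.card + RIMlo.card + RIMhi.card := by
    calc ((P'.filter fun p => p + d ∉ P').filter fun p => p ∉ Λ₁).card
        ≤ (P'N.filter fun p => p + d ∉ P'N).card := card_le_card h0
      _ ≤ (X.filter fun q => q + d ∉ X ∧ ∃ p ∈ P'N, ∃ m : ℕ, q = p + ((m : ℕ) : ℝ) • d).card := by
          convert h1 using 3
      _ ≤ (ENDS ∪ RIMlo ∪ RIMhi).card := card_le_card hsplit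
      _ ≤ (ENDS ∪ RIMlo).card + RIMhi.card := card_union_le _ _
      _ ≤ ENDS.card + RIMlo.card + RIMhi.card := by
          have := card_union_le ENDS RIMlo; omega
  have hcard' : (((P'.filter fun p => p + d ∉ P').filter fun p => p ∉ Λ₁).card : ℝ) ≤
      (ENDS.card : ℝ) + (RIMlo.card : ℝ) + (RIMhi.card : ℝ) := by exact_mod_cast hcard
  linarith

open scoped Classical in
/-- **Located in-plane run ends of the top grain, disjoint grains** (`Λ₁ ∩ Λ₂ = ∅`).  See the module docstring. -/
theorem card_inPlane_runEnds_top_ge_of_disjoint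
    (A₁ : EuclideanSpace ℝ (Fin 3) ≃ₗᵢ[ℝ] EuclideanSpace ℝ (Fin 3)) (t₁ : EuclideanSpace ℝ (Fin 3))
    (A₂ : EuclideanSpace ℝ (Fin 3) ≃ₗᵢ[ℝ] EuclideanSpace ℝ (Fin 3)) (t₂ : EuclideanSpace ℝ (Fin 3))
    (X P₁ P₂ : Finset (EuclideanSpace ℝ (Fin 3))) (R₀ h ρ : ℝ) (hR₀ : 3 ≤ R₀) (hρ : R₀ ≤ ρ)
    (hX : ∀ p ∈ X, ∀ q ∈ X, p ≠ q → 1 ≤ dist p q)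
    (hcell : ∀ p ∈ X, -(2 * R₀) ≤ p 2 ∧ p 2 ≤ h + 2 * R₀ ∧ p 0 ^ 2 + p 1 ^ 2 ≤ ρ ^ 2)
    (hP₁X : P₁ ⊆ X) (hP₂X : P₂ ⊆ X)
    (hP₁ : ∀ p, p ∈ P₁ ↔ (p ∈ (fun q => A₁ q + t₁) '' fccStacking 1 (Real.sqrt (2 / 3)) ∧
      -(2 * R₀) ≤ p 2 ∧ p 2 ≤ -R₀ ∧ p 0 ^ 2 + p 1 ^ 2 ≤ ρ ^ 2))
    (hP₂ : ∀ p, p ∈ P₂ ↔ (p ∈ (fun q => A₂ q + t₂) '' fccStacking 1 (Real.sqrt (2 / 3)) ∧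
      h + R₀ ≤ p 2 ∧ p 2 ≤ h + 2 * R₀ ∧ p 0 ^ 2 + p 1 ^ 2 ≤ ρ ^ 2))
    (hdisj : ∀ p ∈ (fun q => A₂ q + t₂) '' fccStacking 1 (Real.sqrt (2 / 3)),
      p ∉ (fun q => A₁ q + t₁) '' fccStacking 1 (Real.sqrt (2 / 3)))
    {u : EuclideanSpace ℝ (Fin 3)} (hu : u ∈ fccSlots)
    (hdown : ⟪A₂ u, EuclideanSpace.single (2 : Fin 3) (1 : ℝ)⟫_ℝ ≤ 0)
    (hinv₁ : ∀ x, x ∈ (fun q => A₁ q + t₁) '' fccStacking 1 (Real.sqrt (2 / 3)) →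
      x + A₂ u ∈ (fun q => A₁ q + t₁) '' fccStacking 1 (Real.sqrt (2 / 3)) ∧
      x - A₂ u ∈ (fun q => A₁ q + t₁) '' fccStacking 1 (Real.sqrt (2 / 3))) :
    Real.sqrt 2 * |⟪A₂ u, EuclideanSpace.single (2 : Fin 3) (1 : ℝ)⟫_ℝ| * Real.pi * (ρ - 1) ^ 2 -
        10 * Real.sqrt 2 * Real.pi * (ρ - 1) - 72 * R₀ * ρ ≤
      ((X.filter fun e => e ∈ (fun q => A₂ q + t₂) '' fccStacking 1 (Real.sqrt (2 / 3)) ∧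
        e ∉ (fun q => A₁ q + t₁) '' fccStacking 1 (Real.sqrt (2 / 3)) ∧
        e + A₂ u ∉ X ∧ -R₀ - 2 ≤ e 2 ∧ e 2 ≤ h + R₀ + 2).card : ℝ) := by
  obtain ⟨P', hP'def⟩ : ∃ P' : Finset (EuclideanSpace ℝ (Fin 3)), P' = P₂.filter (fun p =>
      h + R₀ + 1 ≤ p 2 ∧ p 2 ≤ h + 2 * R₀ - 1 ∧ p 0 ^ 2 + p 1 ^ 2 ≤ (ρ - 1) ^ 2) := ⟨_, rfl⟩
  have hP' : ∀ p, p ∈ P' ↔ (p ∈ (fun q => A₂ q + t₂) '' fccStacking 1 (Real.sqrt (2 / 3)) ∧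
      h + R₀ + 1 ≤ p 2 ∧ p 2 ≤ h + 2 * R₀ - 1 ∧ p 0 ^ 2 + p 1 ^ 2 ≤ (ρ - 1) ^ 2) := by
    intro p
    rw [hP'def, mem_filter, hP₂]
    constructor
    · rintro ⟨⟨hΛ, -, -, -⟩, h1, h2, h3⟩
      exact ⟨hΛ, h1, h2, h3⟩
    · rintro ⟨hΛ, h1, h2, h3⟩
      have hρ0 : (0 : ℝ) ≤ ρ - 1 := by linarith
      exact ⟨⟨hΛ, by linarith, by linarith, by nlinarith⟩, h1, h2, h3⟩
  have hbase := card_inPlane_runEnds_top_ge_tops A₁ t₁ A₂ t₂ X P₁ P₂ P' R₀ h ρ hR₀ hρ hX hcell hP₁X hP₂X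
    hP₁ hP₂ hP' hu hdown hinv₁
  -- all tops of `P'` are off `Λ₁`
  have hall : ((P'.filter fun p => p + A₂ u ∉ P').filter fun p =>
      p ∉ (fun q => A₁ q + t₁) '' fccStacking 1 (Real.sqrt (2 / 3))) =
      P'.filter fun p => p + A₂ u ∉ P' := by
    refine filter_true_of_mem ?_
    intro p hp
    exact hdisj p ((hP' p).1 (mem_filter.1 hp).1).1
  rw [hall] at hbase
  -- the line count of `P'`
  have hP'w : ∀ p, p ∈ P' ↔ (p ∈ (fun q => A₂ q + t₂) '' fccStacking 1 (Real.sqrt (2 / 3)) ∧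
      (h + R₀ + 1) ≤ p 2 ∧ p 2 ≤ (h + R₀ + 1) + (R₀ - 2) ∧ p 0 ^ 2 + p 1 ^ 2 ≤ (ρ - 1) ^ 2) := by
    intro p; rw [hP' p, show h + R₀ + 1 + (R₀ - 2) = h + 2 * R₀ - 1 by ring]
  obtain ⟨Ea, Eb, hEa, hEb, hdet, hframe, -⟩ := exists_frame_of_mem_fccSlots hu
  have htops := tops_ge_lineCount A₂ t₂ (h + R₀ + 1) (R₀ - 2) (ρ - 1) (by linarith) (by linarith) P' hP'w
    Ea Eb u hEa hEb (norm_eq_one_of_mem_fccSlots hu) hdet hframe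
  linarith

open scoped Classical in
/-- **Located in-plane run ends of the top grain, composition layers present** (co-axial twin pairs: the shift `g`
is one layer of `Λ₂`'s stacking).  See the module docstring. -/
theorem card_inPlane_runEnds_top_ge_of_shift
    (A₁ : EuclideanSpace ℝ (Fin 3) ≃ₗᵢ[ℝ] EuclideanSpace ℝ (Fin 3)) (t₁ : EuclideanSpace ℝ (Fin 3))
    (A₂ : EuclideanSpace ℝ (Fin 3) ≃ₗᵢ[ℝ] EuclideanSpace ℝ (Fin 3)) (t₂ : EuclideanSpace ℝ (Fin 3))
    (X P₁ P₂ : Finset (EuclideanSpace ℝ (Fin 3))) (R₀ h ρ : ℝ) (hR₀ : 5 ≤ R₀) (hρ : R₀ ≤ ρ)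
    (hX : ∀ p ∈ X, ∀ q ∈ X, p ≠ q → 1 ≤ dist p q)
    (hcell : ∀ p ∈ X, -(2 * R₀) ≤ p 2 ∧ p 2 ≤ h + 2 * R₀ ∧ p 0 ^ 2 + p 1 ^ 2 ≤ ρ ^ 2)
    (hP₁X : P₁ ⊆ X) (hP₂X : P₂ ⊆ X)
    (hP₁ : ∀ p, p ∈ P₁ ↔ (p ∈ (fun q => A₁ q + t₁) '' fccStacking 1 (Real.sqrt (2 / 3)) ∧
      -(2 * R₀) ≤ p 2 ∧ p 2 ≤ -R₀ ∧ p 0 ^ 2 + p 1 ^ 2 ≤ ρ ^ 2))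
    (hP₂ : ∀ p, p ∈ P₂ ↔ (p ∈ (fun q => A₂ q + t₂) '' fccStacking 1 (Real.sqrt (2 / 3)) ∧
      h + R₀ ≤ p 2 ∧ p 2 ≤ h + 2 * R₀ ∧ p 0 ^ 2 + p 1 ^ 2 ≤ ρ ^ 2))
    {g : EuclideanSpace ℝ (Fin 3)} (hg1 : ‖g‖ = 1)
    (hgΛ₂ : ∀ p ∈ (fun q => A₂ q + t₂) '' fccStacking 1 (Real.sqrt (2 / 3)),
      p + g ∈ (fun q => A₂ q + t₂) '' fccStacking 1 (Real.sqrt (2 / 3)) ∧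
      p - g ∈ (fun q => A₂ q + t₂) '' fccStacking 1 (Real.sqrt (2 / 3)))
    (hgΛ₁ : ∀ x ∈ (fun q => A₁ q + t₁) '' fccStacking 1 (Real.sqrt (2 / 3)),
      x + g ∉ (fun q => A₁ q + t₁) '' fccStacking 1 (Real.sqrt (2 / 3)) ∧
      x + (2 : ℝ) • g ∉ (fun q => A₁ q + t₁) '' fccStacking 1 (Real.sqrt (2 / 3)))
    {u : EuclideanSpace ℝ (Fin 3)} (hu : u ∈ fccSlots)
    (hdown : ⟪A₂ u, EuclideanSpace.single (2 : Fin 3) (1 : ℝ)⟫_ℝ ≤ 0)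
    (hinv₁ : ∀ x, x ∈ (fun q => A₁ q + t₁) '' fccStacking 1 (Real.sqrt (2 / 3)) →
      x + A₂ u ∈ (fun q => A₁ q + t₁) '' fccStacking 1 (Real.sqrt (2 / 3)) ∧
      x - A₂ u ∈ (fun q => A₁ q + t₁) '' fccStacking 1 (Real.sqrt (2 / 3))) :
    2 / 3 * (Real.sqrt 2 * |⟪A₂ u, EuclideanSpace.single (2 : Fin 3) (1 : ℝ)⟫_ℝ| * Real.pi * (ρ - 2) ^ 2 -
        10 * Real.sqrt 2 * Real.pi * (ρ - 2)) - 72 * R₀ * ρ ≤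
      ((X.filter fun e => e ∈ (fun q => A₂ q + t₂) '' fccStacking 1 (Real.sqrt (2 / 3)) ∧
        e ∉ (fun q => A₁ q + t₁) '' fccStacking 1 (Real.sqrt (2 / 3)) ∧
        e + A₂ u ∉ X ∧ -R₀ - 2 ≤ e 2 ∧ e 2 ≤ h + R₀ + 2).card : ℝ) := by
  set Λ₁ := (fun q => A₁ q + t₁) '' fccStacking 1 (Real.sqrt (2 / 3)) with hΛ₁
  set Λ₂ := (fun q => A₂ q + t₂) '' fccStacking 1 (Real.sqrt (2 / 3)) with hΛ₂
  set d : EuclideanSpace ℝ (Fin 3) := A₂ u with hd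
  have huΛ : u ∈ fccStacking 1 (Real.sqrt (2 / 3)) := mem_fcc_of_mem_fccSlots hu
  have hd1 : ‖d‖ = 1 := by rw [hd, LinearIsometryEquiv.norm_map, norm_eq_one_of_mem_fccSlots hu]
  have hd0 : d ≠ 0 := by
    intro h0; rw [h0, norm_zero] at hd1; norm_num at hd1
  -- the two nested inner samples
  obtain ⟨P', hP'def⟩ : ∃ P' : Finset (EuclideanSpace ℝ (Fin 3)), P' = P₂.filter (fun p =>
      h + R₀ + 1 ≤ p 2 ∧ p 2 ≤ h + 2 * R₀ - 1 ∧ p 0 ^ 2 + p 1 ^ 2 ≤ (ρ - 1) ^ 2) := ⟨_, rfl⟩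
  have hP' : ∀ p, p ∈ P' ↔ (p ∈ Λ₂ ∧
      h + R₀ + 1 ≤ p 2 ∧ p 2 ≤ h + 2 * R₀ - 1 ∧ p 0 ^ 2 + p 1 ^ 2 ≤ (ρ - 1) ^ 2) := by
    intro p
    rw [hP'def, mem_filter, hP₂]
    constructor
    · rintro ⟨⟨hΛ, -, -, -⟩, h1, h2, h3⟩
      exact ⟨hΛ, h1, h2, h3⟩
    · rintro ⟨hΛ, h1, h2, h3⟩
      have hρ0 : (0 : ℝ) ≤ ρ - 1 := by linarith
      exact ⟨⟨hΛ, by linarith, by linarith, by nlinarith⟩, h1, h2, h3⟩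
  obtain ⟨P'', hP''def⟩ : ∃ P'' : Finset (EuclideanSpace ℝ (Fin 3)), P'' = P₂.filter (fun p =>
      h + R₀ + 2 ≤ p 2 ∧ p 2 ≤ h + 2 * R₀ - 2 ∧ p 0 ^ 2 + p 1 ^ 2 ≤ (ρ - 2) ^ 2) := ⟨_, rfl⟩
  have hP'' : ∀ p, p ∈ P'' ↔ (p ∈ Λ₂ ∧
      h + R₀ + 2 ≤ p 2 ∧ p 2 ≤ h + 2 * R₀ - 2 ∧ p 0 ^ 2 + p 1 ^ 2 ≤ (ρ - 2) ^ 2) := by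
    intro p
    rw [hP''def, mem_filter, hP₂]
    constructor
    · rintro ⟨⟨hΛ, -, -, -⟩, h1, h2, h3⟩
      exact ⟨hΛ, h1, h2, h3⟩
    · rintro ⟨hΛ, h1, h2, h3⟩
      have hρ0 : (0 : ℝ) ≤ ρ - 2 := by linarith
      exact ⟨⟨hΛ, by linarith, by linarith, by nlinarith⟩, h1, h2, h3⟩
  have hbase := card_inPlane_runEnds_top_ge_tops A₁ t₁ A₂ t₂ X P₁ P₂ P' R₀ h ρ (by linarith) hρ hX hcell
    hP₁X hP₂X hP₁ hP₂ hP' hu hdown hinv₁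
  -- the two-thirds lemma
  have hN : ∀ q, q ∉ Λ₁ ↔ q + d ∉ Λ₁ := by
    intro q
    constructor
    · intro hq hq'
      have := (hinv₁ (q + d) hq').2
      rw [add_sub_cancel_right] at this
      exact hq this
    · intro hq hq'
      exact hq (hinv₁ q hq').1
  have hshift : ∀ p ∈ P'', ∀ ε ∈ ({-1, 0, 1} : Finset ℝ), p + ε • g ∈ P' := by
    intro p hp ε hε
    obtain ⟨hpΛ, h1, h2, h3⟩ := (hP'' p).1 hp
    have hεg : ‖ε • g‖ ≤ 1 := by
      rw [norm_smul, hg1, mul_one]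
      simp only [mem_insert, mem_singleton] at hε
      rcases hε with rfl | rfl | rfl <;> norm_num
    have hmem : p + ε • g ∈ Λ₂ := by
      simp only [mem_insert, mem_singleton] at hε
      rcases hε with rfl | rfl | rfl
      · rw [neg_one_smul, ← sub_eq_add_neg]; exact (hgΛ₂ p hpΛ).2
      · rw [zero_smul, add_zero]; exact hpΛ
      · rw [one_smul]; exact (hgΛ₂ p hpΛ).1
    have hdist : dist (p + ε • g) p ≤ 1 := by rw [dist_eq_norm, add_sub_cancel_left]; exact hεg
    have hz2 : ((p + ε • g) 2 - p 2) ^ 2 ≤ 1 := by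
      have hsq := dist_sq_eq_three (p + ε • g) p
      have hd1' : dist (p + ε • g) p ^ 2 ≤ 1 := by nlinarith [hdist, dist_nonneg (x := p + ε • g) (y := p)]
      nlinarith [hsq, hd1', sq_nonneg ((p + ε • g) 0 - p 0), sq_nonneg ((p + ε • g) 1 - p 1)]
    have hz : |(p + ε • g) 2 - p 2| ≤ 1 := by
      rw [abs_le]
      constructor <;> nlinarith [hz2, sq_nonneg ((p + ε • g) 2 - p 2 - 1), sq_nonneg ((p + ε • g) 2 - p 2 + 1)]
    have hlat : (p + ε • g) 0 ^ 2 + (p + ε • g) 1 ^ 2 ≤ (ρ - 1) ^ 2 := by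
      have := lateral_sq_le_of_dist_le_one (y := p + ε • g) (q := p) (r := ρ - 2) (by linarith) h3 hdist
      rwa [show ρ - 2 + 1 = ρ - 1 by ring] at this
    rw [abs_le] at hz
    exact (hP' _).2 ⟨hmem, by linarith, by linarith, hlat⟩
  have hconv'' := runConvex_clampedSample A₂ t₂ (h + R₀ + 2) (h + 2 * R₀ - 2) (ρ - 2) (by linarith) P'' hP''
    huΛ
  have htwo : ∀ p ∈ P'', ∃ ε₁ ∈ ({-1, 0, 1} : Finset ℝ), ∃ ε₂ ∈ ({-1, 0, 1} : Finset ℝ),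
      ε₁ ≠ ε₂ ∧ (p + ε₁ • g) ∉ Λ₁ ∧ (p + ε₂ • g) ∉ Λ₁ := by
    intro p hp
    have hm1 : (-1 : ℝ) ∈ ({-1, 0, 1} : Finset ℝ) := by simp
    have h0 : (0 : ℝ) ∈ ({-1, 0, 1} : Finset ℝ) := by simp
    have hp1 : (1 : ℝ) ∈ ({-1, 0, 1} : Finset ℝ) := by simp
    by_cases hpΛ₁ : p ∈ Λ₁
    · -- `p` on `Λ₁`: both neighbours off `Λ₁`
      refine ⟨-1, hm1, 1, hp1, by norm_num, ?_, ?_⟩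
      · intro h'
        have := (hgΛ₁ _ h').1
        rw [neg_one_smul, neg_add_cancel_right] at this
        exact this hpΛ₁
      · rw [one_smul]; exact (hgΛ₁ p hpΛ₁).1
    · by_cases hm : p + (-1 : ℝ) • g ∈ Λ₁
      · refine ⟨0, h0, 1, hp1, by norm_num, by rw [zero_smul, add_zero]; exact hpΛ₁, ?_⟩
        have := (hgΛ₁ _ hm).2
        rw [neg_one_smul, add_assoc, show -g + (2 : ℝ) • g = (1 : ℝ) • g by module] at this
        exact this
      · exact ⟨-1, hm1, 0, h0, by norm_num, hm, by rw [zero_smul, add_zero]; exact hpΛ₁⟩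
  have h23 : 2 * (P''.filter fun p => p + d ∉ P'').card ≤
      3 * ((P'.filter fun p => p + d ∉ P').filter fun p => p ∉ Λ₁).card := by
    convert two_mul_card_tops_le_three_mul P' P'' d g hd0 (fun q => q ∉ Λ₁) hshift hconv'' hN htwo
      using 6
  -- the line count of `P''`
  have hP''w : ∀ p, p ∈ P'' ↔ (p ∈ Λ₂ ∧
      (h + R₀ + 2) ≤ p 2 ∧ p 2 ≤ (h + R₀ + 2) + (R₀ - 4) ∧ p 0 ^ 2 + p 1 ^ 2 ≤ (ρ - 2) ^ 2) := by
    intro p; rw [hP'' p, show h + R₀ + 2 + (R₀ - 4) = h + 2 * R₀ - 2 by ring]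
  obtain ⟨Ea, Eb, hEa, hEb, hdet, hframe, -⟩ := exists_frame_of_mem_fccSlots hu
  have htops := tops_ge_lineCount A₂ t₂ (h + R₀ + 2) (R₀ - 4) (ρ - 2) (by linarith) (by linarith) P'' hP''w
    Ea Eb u hEa hEb (norm_eq_one_of_mem_fccSlots hu) hdet hframe
  have h23' : (2 : ℝ) * ((P''.filter fun p => p + d ∉ P'').card : ℝ) ≤
      3 * (((P'.filter fun p => p + d ∉ P').filter fun p => p ∉ Λ₁).card : ℝ) := by exact_mod_cast h23
  linarith

end Summit.Ventures.Crystal3D.Theorems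

end
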